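import Summits.BirchSwinnertonDyer.BirchSwinnertonDyer.Theorems.PrintCFramAcDescentThreeSplitDefs
import HarnessLib

/-!
# The `p = 3` split (A)/(B) of `AnticyclotomicSpecialisationAtZpThree W` RE-TYPED over the
# `End_K(E_K)`-ORBIT SPAN `Λ_𝒪 · z^ac` (cell `bsd-print-cfram`, D-0131 (2) PRINT tier, prover seat p2
# gen 3, strategy «Rubin 1991 / JLK two-variable main conjecture → anticyclotomic descent»; item
# `EllipticUnitIMCThree` = stmt-BirchSwinnertonDyer-21353, line «acdescent3»;
# `--supports stmt-BirchSwinnertonDyer-21353`)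

NOTHING is asserted: one definition (a `Λ`-submodule of the pinned relaxed `Λ`-adic Selmer datum),
two `@[conjecture]` `Prop`s per curve (plus slice forms), bookkeeping lemmas and the PROVED joins.
This file REPAIRS the carrier of p1's split `PrintCFramAcDescentThreeSplitDefs.lean` (p566137), whose
two pieces it leaves untouched (append-only tree).

## The defect repaired (p2 g3 audit, HOME/STATUS 2026-08-27T20:51:58Z)

Piece (A) `AcDescentThreeSplit.AcMainConjectureAtZpThree W` asks, for EVERY relaxed `Λ`-adic datum `𝒮`
(such data exist: p1's `nonempty_lambdaAdicRelaxedSelmerData`), that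
`𝒮.S ⧸ Submodule.span Λ {zac}` be `Λ`-TORSION, where `Λ = IwasawaAlgebra 3 = ℤ₃⟦T⟧` and
`Submodule.span Λ {zac}` is the CYCLIC `Λ`-submodule generated by the anticyclotomic class (`Λ`-rank
`≤ 1`). But `𝒮.S ≅ {norm-compatible families in the relaxed compact Selmer groups Sel_rel(K^ac_n, T₃E)}`
(fields `ext`/`surj`; `torsionH1Over (3^k)` is `H¹(K^ac_n, E[3^k])` with the FULL `E[3^k]`) is
[BKNO]'s `𝒮^ac_rel`, «of rank one» over `Λ_ac = 𝒪⟦Γ⟧`, `𝒪 ⊇ 𝒪_{K_𝔭}` (Prop. 3.7 (3)), i.e. of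
`ℤ₃⟦T⟧`-rank `[𝒪_𝔭 : ℤ₃] = 2` (Euler–Poincaré count at layer `n`:
`h¹_rel(K_n, V) − h¹_str(K_n, V) = Σ_{w ∣ 𝔭} 2 [K_{n,w} : ℚ₃] − 2·#{v ∣ ∞} = 4·3ⁿ − 2·3ⁿ = 2·3ⁿ`).
So `𝒮.S ⧸ Λ·zac` has `Λ`-rank `≥ 1` and is never torsion: (A) is false in intent on every regime-N
frame, and (B)'s antecedent is unsatisfiable. [BKNO] Prop. 3.7 (4) / Thm. 3.14 divide by
`Λ_ac · z^ac` = the `𝒪⟦Γ⟧`-SPAN; the tree's bottom-layer carrier was corrected the same way by the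
`bsd-cm` cell (D117: `endSpan` ↦ `padicEndSpan` = `(End_K(E) ⊗ ℤ_p)`-span, which piece (B)'s own
`HasBottomIndexExpZp` already uses). The kernel face of the obstruction is
`exists_smul_eq_smul_of_isTorsion_quotient_span`: torsion of `𝒮.S ⧸ Λ·zac` forces EVERY element of
`𝒮.S` — in particular the `[ω]`-translate of `z^ac` — to satisfy `a • s = b • zac` with `a` a
non-zero-divisor, i.e. `(a[ω] − b) · z^ac = 0` in `End ⊗ Λ`: the elliptic-unit family would be
`Λ_𝒪`-torsion, against [BKNO] Prop. 3.7 (1) (Rohrlich + the explicit reciprocity law).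

## The repair

* `endOrbit 𝒮 z` / `endOrbitSpan 𝒮 z` — for a family `z = (z_n)_n` of level-wise classes, the set of
  elements of `𝒮.S` projecting to an `End_K(E_K)`-translate `(φ · z_n)_n` of `z`, and its `Λ`-span:
  in intent `Λ_𝒪 · z^ac` (`𝒪 = End_K(E_K) ⊗ ℤ₃`, `Λ`-rank `2`), the module [BKNO] divide by. HONEST-∃
  shape: if some translate family were not relaxed-Selmer / norm-compatible, no element projects to
  it and the span only SHRINKS (the conjecture below only strengthens); `zac ∈ endOrbitSpan 𝒮 D.z`
  (`φ = [1]`, `mem_endOrbit_of_proj_eq`), so `Λ·zac ≤ endOrbitSpan` (`span_le_endOrbitSpan_of_proj_eq`).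
  Same ring `End_K(E_K) ⊗ –` as `padicEndSpan` downstairs, so the exponent `c` of
  `HasBottomIndexExpZp` is its `T = 0` shadow.
* (A𝒪) `AcMainConjectureOrbitAtZpThree W` — p1's (A) VERBATIM (all binders, the JLK antecedent, the
  regime-N binders, the pinned datum) with `Submodule.span Λ {zac}` replaced by `endOrbitSpan 𝒮 D.z`
  (no `zac` binder needed): `∀ 𝒮, IsTorsion (𝒮.S ⧸ endOrbitSpan 𝒮 D.z) ∧ IsTorsion X ∧
  charIdeal Λ (𝒮.S ⧸ endOrbitSpan 𝒮 D.z) = charIdeal Λ X`. Over `Λ = ℤ₃⟦T⟧` the characteristic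
  ideal of a `Λ_𝒪`-module is the norm of its `Λ_𝒪`-characteristic ideal, so this is IMPLIED by
  [BKNO]'s `𝒪`-identity and SUFFICIENT for the `T = 0` reading (which only sees `3`-adic valuations
  of `ℤ₃`-cardinalities). `@[conjecture]`; PRE / beyond print at `3` (as (A)).
* (B𝒪) `AcBottomReadingOrbitAtZpThree W` — p1's (B) VERBATIM with (A𝒪)'s conclusion as antecedent.
* JOINS (PROVED, logic, as in p1's file): `anticyclotomicSpecialisationAtZpThree_of_orbit`,
  `ramifiedCMEllipticUnitIMCAtZpThree_of_sec54_of_orbit`, slice forms `AcMainConjectureOrbitThree` /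
  `AcBottomReadingOrbitThree`, `anticyclotomicSpecialisationThree_of_orbit`,
  `forall_imcAtZpThree_of_sec54_of_orbit` (the body of item 21353), and the comparison
  `isTorsion_quotient_endOrbitSpan_of_isTorsion_quotient_span` ((A)'s torsion conjunct implies
  (A𝒪)'s — it is the too-strong one).

ORDER CAVEAT. On the `j = −12288000` members `End_K(E_K) = ℤ[3ζ₃]` (conductor `3`), so
`End ⊗ ℤ₃ ⊊ 𝒪_𝔭` has index `3` and `Λ_{𝒪'}·z` differs from `Λ_{𝒪_K}·z` by a `Λ/3`-factor (characteristic
ideal `(3)`): the identity is stated for the curve's OWN endomorphism order, consistently with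
`padicEndSpan` downstairs; which member of a mixed class carries the frame is `IsFrameThree`'s business.
HONEST LIMITS as in p1's file: (A𝒪) ∧ (B𝒪) ⟹ the lemma, not conversely; JLK's fact keeps its reading
flag `JLK11-sec54-Rubin-modules`; nothing is closed — item 21353, regime N, C1 and the leaf stay OPEN.
«beyond-print theorem»: NO (typing repair + bookkeeping).

References: [BurungaleKobayashiNakamuraOta2026] arXiv:2608.06879v1 §3.1.3 (`𝒪`, `T`), §3.2.2
(`Λ_∗ = 𝒪⟦Gal(K^∗_∞/K)⟧`, `𝒮^ac_rel`), Prop. 3.7 (1)/(3)/(4), Thm. 3.14 (pp. 15–24) (claim; preprint);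
[Rubin1991] §4 (the two-variable modules are `Λ_𝒪`-modules); [JohnsonLeungKings2011] §5.4;
[GreenbergLNM1716] §4 Lemma 4.2; tree `BurungaleKobayashiNakamuraOta2026/PadicEndSpan.lean`
(`padicEndSpan`, D117), `…/AnticyclotomicEllipticUnitClass.lean` (`endPi`, `endSpan`),
`Theorems/PrintCFramAcDescentThreeSplitDefs.lean` (p566137); cell HOME/STATUS 2026-08-27T20:51:58Z.
-/

-- the summit namespace `Summit.BirchSwinnertonDyer.BirchSwinnertonDyer` repeats the problem name by design (D-0017)
set_option linter.dupNamespace false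

noncomputable section

open scoped Classical

open WeierstrassCurve NumberField IsDedekindDomain Field Module PowerSeries
  Literature.NumberTheory.GaloisRepresentations
  Literature.NumberTheory.EllipticCurves
  Literature.NumberTheory.EllipticCurves.Rank1Residual
  Literature.NumberTheory.EllipticCurves.Rank1Residual.Typed
  Literature.NumberTheory.EllipticCurves.Castella2018
  Literature.NumberTheory.EllipticCurves.BurungaleKobayashiNakamuraOta2026
  Literature.NumberTheory.EllipticCurves.KellerYin2024
  Literature.NumberTheory.ComplexMultiplication.EllipticUnits
  Literature.NumberTheory.ComplexMultiplication.EllipticUnits.JohnsonLeungKings2011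
  Literature.NumberTheory.NumberFields
  Summit.BirchSwinnertonDyer.Rank1Residual.Additive
  Summit.BirchSwinnertonDyer.Rank1Residual.X12.O11
  Summit.BirchSwinnertonDyer.BirchSwinnertonDyer.Theorems.PrintCFram.AcDescentThreeSplit

namespace Summit.BirchSwinnertonDyer.BirchSwinnertonDyer.Theorems.PrintCFram.AcDescentThreeOrbit

/-! ## §1 The `End_K(E_K)`-orbit span of a family inside a relaxed `Λ`-adic datum -/

section Orbit

variable {K : Type} [Field K] [NumberField K] {p : ℕ} [Fact p.Prime]
  {V : WeierstrassCurve K} {κ : ZpExtension K p} {γ : absoluteGaloisGroup K}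
  {𝔭 : HeightOneSpectrum (𝓞 K)}

omit [NumberField K] [Fact p.Prime] in
/-- **`[1] · x = x`** for the tree's `endPi` (the identity of `End_K(E)` acts trivially on
`∏_k H¹(H, E[p^k])`; the computation inside `WeierstrassCurve.self_mem_endSpan`, exposed).
[cite: SilvermanAEC2009, III.4 (End(E) is a ring with identity `[1]`)] -/
theorem endPi_one_apply (H : Subgroup (absoluteGaloisGroup K))
    (x : Π k : ℕ, V.torsionH1Over ((p : ℤ) ^ k) H) : V.endPi V.endRing.one_mem p H x = x := by
  ext k
  change V.endH1 V.endRing.one_mem ((p : ℤ) ^ k) H (x k) = x k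
  have h1 : V.endTorsion V.endRing.one_mem ((p : ℤ) ^ k) = AddMonoidHom.id _ := by
    ext P; rfl
  rw [endH1, resH1Hom_congr rfl h1 _ (fun _ _ ↦ rfl), resH1Hom_id]
  rfl

/-- **The `End_K(E_K)`-orbit of a family `z = (z_n)_n` inside a relaxed `Λ`-adic datum `𝒮`**: the
elements of `𝒮.S` whose projections are an `End_K(E_K)`-translate `(φ · z_n)_n` of `z` (honest-∃:
only translates that ARE norm-compatible relaxed-Selmer families occur). For a CM curve over its CM
field: the `𝒪`-translates of `z^ac`, `𝒪 = End_K(E_K)`. [cite: BurungaleKobayashiNakamuraOta2026, §3.3.1 and Prop. 3.7 (4) (arXiv:2608.06879v1 pp. 19–20) (the module `Λ_ac z^{ac}`; shape only)] -/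
def endOrbit (𝒮 : LambdaAdicRelaxedSelmerData V κ γ 𝔭)
    (z : Π n k : ℕ, V.torsionH1Over ((p : ℤ) ^ k) (κ.layerSubgroup n)) : Set 𝒮.S :=
  {s | ∃ (φ : AddMonoid.End V.geomPoints) (hφ : φ ∈ V.endRing),
    ∀ n, 𝒮.proj n s = V.endPi hφ p (κ.layerSubgroup n) (z n)}

/-- **The `End_K(E_K)`-ORBIT SPAN `Λ_𝒪 · z` inside `𝒮.S`**: the `Λ = ℤ_p⟦T⟧`-span of `endOrbit 𝒮 z` —
in intent [BKNO]'s `Λ_ac · z^ac` with `Λ_ac = 𝒪⟦Γ⟧` (`Λ`-rank `[𝒪 : ℤ_p]`), the module divided out in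
Prop. 3.7 (4) / Thm. 3.14; the `Λ`-adic twin of the bottom-layer carrier `padicEndSpan`
(`(End_K(E) ⊗ ℤ_p)`-span, D117). [cite: BurungaleKobayashiNakamuraOta2026, §3.2.2, §3.3.1 and Prop. 3.7 (4) (arXiv:2608.06879v1 pp. 18–20) (shape only)] -/
def endOrbitSpan (𝒮 : LambdaAdicRelaxedSelmerData V κ γ 𝔭)
    (z : Π n k : ℕ, V.torsionH1Over ((p : ℤ) ^ k) (κ.layerSubgroup n)) :
    Submodule (IwasawaAlgebra p) 𝒮.S :=
  Submodule.span (IwasawaAlgebra p) (endOrbit 𝒮 z)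

/-- An element projecting to `z` itself lies in the orbit (`φ = [1]`). [cite: SilvermanAEC2009, III.4 (the identity `[1] ∈ End(E)`)] -/
theorem mem_endOrbit_of_proj_eq (𝒮 : LambdaAdicRelaxedSelmerData V κ γ 𝔭)
    {z : Π n k : ℕ, V.torsionH1Over ((p : ℤ) ^ k) (κ.layerSubgroup n)} {s : 𝒮.S}
    (hs : ∀ n, 𝒮.proj n s = z n) : s ∈ endOrbit 𝒮 z :=
  ⟨1, V.endRing.one_mem, fun n ↦ by rw [hs n, endPi_one_apply]⟩

/-- An element projecting to `z` lies in the orbit span `Λ_𝒪 · z`. [cite: BurungaleKobayashiNakamuraOta2026, (3.9) "z^ac ∈ 𝒮^ac_rel" (arXiv:2608.06879v1 p. 19) (claim; preprint; shape only)] -/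
theorem mem_endOrbitSpan_of_proj_eq (𝒮 : LambdaAdicRelaxedSelmerData V κ γ 𝔭)
    {z : Π n k : ℕ, V.torsionH1Over ((p : ℤ) ^ k) (κ.layerSubgroup n)} {s : 𝒮.S}
    (hs : ∀ n, 𝒮.proj n s = z n) : s ∈ endOrbitSpan 𝒮 z :=
  Submodule.subset_span (mem_endOrbit_of_proj_eq 𝒮 hs)

/-- **`Λ · zac ≤ Λ_𝒪 · z`**: the cyclic span of an element projecting to `z` is contained in the orbit
span. [cite: BurungaleKobayashiNakamuraOta2026, §3.3.1 (arXiv:2608.06879v1 p. 19) (shape only)] -/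
theorem span_le_endOrbitSpan_of_proj_eq (𝒮 : LambdaAdicRelaxedSelmerData V κ γ 𝔭)
    {z : Π n k : ℕ, V.torsionH1Over ((p : ℤ) ^ k) (κ.layerSubgroup n)} {s : 𝒮.S}
    (hs : ∀ n, 𝒮.proj n s = z n) :
    Submodule.span (IwasawaAlgebra p) {s} ≤ endOrbitSpan 𝒮 z := by
  rw [Submodule.span_singleton_le_iff_mem]
  exact mem_endOrbitSpan_of_proj_eq 𝒮 hs

/-- **How the orbit acquires its other generators** (the `𝒪`-direction): every `End_K(E_K)`-translate
family `(φ · z_n)_n` that is again a norm-compatible family of relaxed compact Selmer classes is the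
projection of a (unique) element of `𝒮.S`, which lies in `endOrbit 𝒮 z` — for a CM curve over its CM
field and `φ = [ω]` this is the second `Λ`-generator of `Λ_𝒪 · z^ac` (the translates ARE such
families: `End_K(E_K)` commutes with `Γ_K` and preserves the Kummer local conditions).
[cite: BurungaleKobayashiNakamuraOta2026, §3.2.1 and §3.3.1 (arXiv:2608.06879v1 pp. 17, 19) (`T` and `𝒮^ac_rel` as `𝒪`-modules; shape only)] -/
theorem exists_mem_endOrbit_of_translate (𝒮 : LambdaAdicRelaxedSelmerData V κ γ 𝔭)
    {z : Π n k : ℕ, V.torsionH1Over ((p : ℤ) ^ k) (κ.layerSubgroup n)}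
    {φ : AddMonoid.End V.geomPoints} (hφ : φ ∈ V.endRing)
    (hmem : ∀ n, V.endPi hφ p (κ.layerSubgroup n) (z n) ∈
      V.relaxedCompactSelmerOver (κ.layerSubgroup n) p {𝔭})
    (hnorm : ∀ n, V.resPi p (κ.layerSubgroup_antitone (Nat.le_succ n))
        (V.endPi hφ p (κ.layerSubgroup n) (z n)) =
      ∑ i ∈ Finset.range p, V.conjPi p (κ.layerSubgroup (n + 1)) (γ ^ (p ^ n * i))
        (V.endPi hφ p (κ.layerSubgroup (n + 1)) (z (n + 1)))) :
    ∃ s ∈ endOrbit 𝒮 z, ∀ n, 𝒮.proj n s = V.endPi hφ p (κ.layerSubgroup n) (z n) := by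
  obtain ⟨s, hs⟩ := 𝒮.surj (fun n ↦ V.endPi hφ p (κ.layerSubgroup n) (z n)) hmem hnorm
  exact ⟨s, ⟨φ, hφ, hs⟩, hs⟩

end Orbit

/-! ## §2 Two algebraic bookkeeping lemmas (any commutative ring) -/

section Algebra

variable {R : Type*} [CommRing R] {M : Type*} [AddCommGroup M] [Module R M]

/-- **Torsion of a quotient passes to quotients by larger submodules**: if `M ⧸ N` is `R`-torsion and
`N ≤ N'` then `M ⧸ N'` is `R`-torsion. (So (A)'s torsion conjunct, over the cyclic span, IMPLIES
(A𝒪)'s, over the orbit span — it is the too-strong one.) [folklore] -/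
theorem isTorsion_quotient_mono {N N' : Submodule R M} (h : N ≤ N')
    (hN : Module.IsTorsion R (M ⧸ N)) : Module.IsTorsion R (M ⧸ N') := by
  intro x
  induction x using Submodule.Quotient.induction_on with
  | H m =>
    obtain ⟨a, ha⟩ := @hN (Submodule.Quotient.mk m)
    refine ⟨a, ?_⟩
    rw [← Submodule.Quotient.mk_smul, Submodule.Quotient.mk_eq_zero] at ha ⊢
    exact h ha

/-- **The kernel face of the rank obstruction**: if `M ⧸ R∙z` is `R`-torsion then EVERY `s ∈ M`
satisfies `a • s = b • z` for some non-zero-divisor `a` and some `b` — applied to `M = 𝒮.S` and `s` the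
`[ω]`-translate of `z^ac`, this says `(a[ω] − b) · z^ac = 0` with `a[ω] − b ≠ 0` in `End ⊗ Λ`, i.e. the
elliptic-unit family would be `Λ_𝒪`-torsion (against [BKNO] Prop. 3.7 (1)). [folklore] -/
theorem exists_smul_eq_smul_of_isTorsion_quotient_span {z : M}
    (h : Module.IsTorsion R (M ⧸ Submodule.span R {z})) (s : M) :
    ∃ a ∈ nonZeroDivisors R, ∃ b : R, a • s = b • z := by
  obtain ⟨a, ha⟩ := @h (Submodule.Quotient.mk s)
  rw [← Submodule.Quotient.mk_smul, Submodule.Quotient.mk_eq_zero, Submodule.mem_span_singleton] at ha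
  obtain ⟨b, hb⟩ := ha
  exact ⟨a, a.2, b, hb.symm⟩

end Algebra

/-! ## §3 The two pinned pieces over the orbit span, at a curve `W` of the `p = 3` slice -/

variable (W : WeierstrassCurve ℚ) [W.IsElliptic] [W.IsGloballyMinimal]

/-- **(A𝒪) The anticyclotomic elliptic-unit MAIN CONJECTURE at `Λ^ac`-level, at the ramified `3`,
RELATIVE to JLK's two-variable identity for `η_E`, over the ORBIT SPAN `Λ_𝒪 · z^ac`** (`@[conjecture]`,
NOTHING asserted). Binders VERBATIM those of p1's `AcMainConjectureAtZpThree W` (3-frame of analytic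
rank one; `h_K = 1`, `𝔭` unique; `(Φ, η)` with the defining properties of `η_E` at `3`; JLK's identity
for `η`; anticyclotomic `κ`, generator `γ`; regime-N binders (A𝔭)₃, (Av)₃). Conclusion: SOME pinned
datum `(ι, φ, Ω ≠ 0, 𝓔, D)` (`L(φ, s) = L(W, s)`) such that for EVERY relaxed `Λ^ac`-adic datum `𝒮`:
`𝒮.S ⧸ Λ_𝒪·z^ac` (`endOrbitSpan 𝒮 D.z`) and `X = XAc (W_K) 3 κ 𝔭 ∅ γ` are `Λ`-torsion and
`char_Λ(𝒮.S ⧸ Λ_𝒪·z^ac) = char_Λ(X)` (`Λ = ℤ₃⟦T⟧`; the norm to `Λ` of [BKNO]'s `Λ_𝒪`-identity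
Prop. 3.7 (2)–(4) + Thm. 3.14 (3) at `p = 3`, with [JohnsonLeungKings2011] §5.4 replacing Rubin in
Prop. 3.9 (2); «(D5)» = the char-level descent `Λ₂ → Λ^ac`). REPAIRS p1's (A) (cyclic `Λ`-span ↦ orbit
span; module docstring). PRE / beyond print at `3`. OPEN. **ERRATUM (referee R0.28):** `X = XAc … ∅ γ`
is the MINIMAL dual; the two-variable identity descends to the GREENBERG form (`char X_Gr = char X_min ·
(3)^{t_cs}`, Pollack–Weston 2011 §3), so on regime-N classes with `t_cs ≥ 1` this identity (like item
21353's body) is short by `(3)^{t_cs}`; successor: `AcMainConjectureOrbitGrAtZpThree` (line «orbit-imc»).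
[cite: BurungaleKobayashiNakamuraOta2026, Prop. 3.7 (2)–(4), Prop. 3.9 (2), Thm. 3.14 (3) (arXiv:2608.06879v1 pp. 19–24) (claim; preprint; shape only)]
[cite: JohnsonLeungKings2011, §5.4 (arXiv:0804.2828 p0016:L19–26) (the antecedent; shape only)] -/
@[conjecture] def AcMainConjectureOrbitAtZpThree : Prop :=
  ∀ (K : Type) [Field K] [NumberField K] (𝔭 : HeightOneSpectrum (𝓞 K))
    (W' : WeierstrassCurve ℚ) [W'.IsElliptic] [W'.IsGloballyMinimal] (C : VariableChange ℚ),
    IsFrameThree W K 𝔭 W' C → W.analyticRank = 1 →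
    NumberField.classNumber K = 1 →
    (∀ w : HeightOneSpectrum (𝓞 K), ((3 : ℕ) : 𝓞 K) ∈ w.asIdeal → w = 𝔭) →
    ∀ (Φ : AddSubgroup (W.baseChange K).geomPoints)
      (η : FramedGaloisRep K (padicCoeffIntegers (∅ : Set (PadicAlgCl 3))) 1),
      Nat.card Φ = 3 → Φ ≤ geomTorsion (W.baseChange K) (3 : ℤ) →
      (∀ σ : absoluteGaloisGroup K, ∀ P ∈ Φ, σ • P ∈ Φ) →
      IsResidualPairOver (W.baseChange K) 3 η η → IsTeichmullerLiftOn ∅ Φ η →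
      (∀ σ : absoluteGaloisGroup K, η σ = 1 ↔ ∀ P ∈ Φ, σ • P = P) →
      (∀ {K₀ : IntermediateField K (AlgebraicClosure K)},
        K₀.fixingSubgroup = (η.toMonoidHom.ker).map (absoluteGaloisGroup.toAlgEquiv K).toMonoidHom →
        ∀ {κ₁ κ₂ : ZpExtension K 3} {γ₁ γ₂ : absoluteGaloisGroup K},
          ZpExtension.IsTopGeneratorPair κ₁ κ₂ γ₁ γ₂ → η γ₁ = 1 → η γ₂ = 1 →
          ∀ (ι : K →+* ℂ) (D : ClassGroupDualData₂ κ₁ κ₂ η γ₁ γ₂)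
            (E : UnitIndexData₂ ι K₀ κ₁ κ₂ η γ₁ γ₂),
            Module.Finite (IwasawaAlgebra₂ 3) D.X ∧ Module.IsTorsion (IwasawaAlgebra₂ 3) D.X ∧
              Module.Finite (IwasawaAlgebra₂ 3) E.Q ∧ Module.IsTorsion (IwasawaAlgebra₂ 3) E.Q ∧
              Module.charIdeal (IwasawaAlgebra₂ 3) D.X = Module.charIdeal (IwasawaAlgebra₂ 3) E.Q) →
      ∀ (κ : ZpExtension K 3), κ.IsAnticyclotomic →
        ∀ (γ : absoluteGaloisGroup K) [Fact (κ.IsTopGenerator γ)],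
          (∀ Q : (W.baseChange ℚ_[3]).toAffine.Point, (3 : ℕ) • Q = 0 → Q = 0) →
          (∀ Q : (W'.baseChange ℚ_[3]).toAffine.Point, (3 : ℕ) • Q = 0 → Q = 0) →
          (∀ v : HeightOneSpectrum (𝓞 K), ((3 : ℕ) : 𝓞 K) ∉ v.asIdeal →
            v.asIdeal.ramificationIdx (𝓞 ℚ) = 1 → v.asIdeal.inertiaDeg (𝓞 ℚ) = 1 →
            (W.baseChange K).HasGoodReductionAt v ∨
              ∀ R : ((W.baseChange K).baseChange (v.adicCompletion K)).toAffine.Point,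
                (3 : ℕ) • R = 0 → R = 0) →
          ∃ (ι : PadicAlgCl 3 ≃+* ℂ) (φ : HeckeCharacter K) (Ω : ℂ) (𝓔 : AcDualExpSystem W 3 K 𝔭 κ ι)
            (D : EllipticUnitClassData W 3 K 𝔭 κ γ ι φ Ω 𝓔),
            Ω ≠ 0 ∧ (∀ s : ℂ, 3 / 2 < s.re → heckeLFunction φ s = W.LSeries s) ∧
            ∀ (𝒮 : LambdaAdicRelaxedSelmerData (W.baseChange K) κ γ 𝔭),
              Module.IsTorsion (IwasawaAlgebra 3) (𝒮.S ⧸ endOrbitSpan 𝒮 D.z) ∧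
              Module.IsTorsion (IwasawaAlgebra 3) (AcSelmer.XAc (W.baseChange K) 3 κ 𝔭 ∅ γ) ∧
              Module.charIdeal (IwasawaAlgebra 3) (𝒮.S ⧸ endOrbitSpan 𝒮 D.z) =
                Module.charIdeal (IwasawaAlgebra 3) (AcSelmer.XAc (W.baseChange K) 3 κ 𝔭 ∅ γ)

/-- **(B𝒪) The BOTTOM-LAYER (`T = 0`) READING at the ramified `3`, over the orbit span**
(`@[conjecture]`, NOTHING asserted): p1's `AcBottomReadingAtZpThree W` VERBATIM with the antecedent
replaced by (A𝒪)'s conclusion — at every `3`-frame of analytic rank one, on regime N, for EVERY pinned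
datum `(ι, φ, Ω ≠ 0, 𝓔, D)` (`L(φ, s) = L(W, s)`) satisfying the `Λ^ac`-identity over `Λ_𝒪·z^ac` for
all relaxed data `𝒮`, there is `c` with `D.HasBottomIndexExpZp c` (the `(End_K(E) ⊗ ℤ₃)`-span
downstairs — the same ring) and the `T = 0` identity `n₀ + log₃ #X[T] = c` whenever `ord₃ f(0) = n₀`
and `X[T]` is finite: «(D6) + the `T = 0` reading» — Euler characteristic of `X` at `T = 0`, control
of `𝒮.S ⧸ Λ_𝒪·z^ac` at the bottom layer (`𝒮.S/T ↪ S_rel(K, T)/tors` with cokernel of order `#X[T]`,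
p2 g2 scoping 2026-08-27T20:32Z) and the `𝔭`-adic index dictionary. Beyond print at the ramified
`3`. OPEN. [cite: GreenbergLNM1716, §4 Lemma 4.2 (p. 85) (Euler characteristic; shape only)]
[cite: BurungaleKobayashiNakamuraOta2026, §3.2.2 and Thm. 3.14 (arXiv:2608.06879v1 pp. 18, 24) (claim; preprint; shape only)] -/
@[conjecture] def AcBottomReadingOrbitAtZpThree : Prop :=
  ∀ (K : Type) [Field K] [NumberField K] (𝔭 : HeightOneSpectrum (𝓞 K))
    (W' : WeierstrassCurve ℚ) [W'.IsElliptic] [W'.IsGloballyMinimal] (C : VariableChange ℚ),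
    IsFrameThree W K 𝔭 W' C → W.analyticRank = 1 →
    ∀ (κ : ZpExtension K 3), κ.IsAnticyclotomic →
      ∀ (γ : absoluteGaloisGroup K) [Fact (κ.IsTopGenerator γ)],
        (∀ Q : (W.baseChange ℚ_[3]).toAffine.Point, (3 : ℕ) • Q = 0 → Q = 0) →
        (∀ Q : (W'.baseChange ℚ_[3]).toAffine.Point, (3 : ℕ) • Q = 0 → Q = 0) →
        (∀ v : HeightOneSpectrum (𝓞 K), ((3 : ℕ) : 𝓞 K) ∉ v.asIdeal →
          v.asIdeal.ramificationIdx (𝓞 ℚ) = 1 → v.asIdeal.inertiaDeg (𝓞 ℚ) = 1 →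
          (W.baseChange K).HasGoodReductionAt v ∨
            ∀ R : ((W.baseChange K).baseChange (v.adicCompletion K)).toAffine.Point,
              (3 : ℕ) • R = 0 → R = 0) →
        ∀ (ι : PadicAlgCl 3 ≃+* ℂ) (φ : HeckeCharacter K) (Ω : ℂ) (𝓔 : AcDualExpSystem W 3 K 𝔭 κ ι)
          (D : EllipticUnitClassData W 3 K 𝔭 κ γ ι φ Ω 𝓔),
          Ω ≠ 0 → (∀ s : ℂ, 3 / 2 < s.re → heckeLFunction φ s = W.LSeries s) →
          (∀ (𝒮 : LambdaAdicRelaxedSelmerData (W.baseChange K) κ γ 𝔭),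
            Module.IsTorsion (IwasawaAlgebra 3) (𝒮.S ⧸ endOrbitSpan 𝒮 D.z) ∧
            Module.IsTorsion (IwasawaAlgebra 3) (AcSelmer.XAc (W.baseChange K) 3 κ 𝔭 ∅ γ) ∧
            Module.charIdeal (IwasawaAlgebra 3) (𝒮.S ⧸ endOrbitSpan 𝒮 D.z) =
              Module.charIdeal (IwasawaAlgebra 3) (AcSelmer.XAc (W.baseChange K) 3 κ 𝔭 ∅ γ)) →
          ∃ c : ℕ, D.HasBottomIndexExpZp c ∧
            ∀ (n₀ : ℕ), AcSelmer.XAc.HasCharValuationAt (W.baseChange K) 3 κ 𝔭 ∅ γ n₀ →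
              Finite {x : AcSelmer.XAc (W.baseChange K) 3 κ 𝔭 ∅ γ //
                (PowerSeries.X : IwasawaAlgebra 3) • x = 0} →
              (n₀ : ℤ) + padicValNat 3 (Nat.card {x : AcSelmer.XAc (W.baseChange K) 3 κ 𝔭 ∅ γ //
                  (PowerSeries.X : IwasawaAlgebra 3) • x = 0}) = c

/-! ## §4 The proved joins at a curve `W` -/

variable {W}

omit [W.IsGloballyMinimal] in
/-- **(A𝒪) ∧ (B𝒪) ⟹ the descent lemma `AnticyclotomicSpecialisationAtZpThree W`** (PROVED; logic over
the shared binders: (A𝒪) yields the pinned datum with the `Λ^ac`-identity over the orbit span, (B𝒪)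
reads it at `T = 0`). [cite: BurungaleKobayashiNakamuraOta2026, Thm. 3.14 (3) (arXiv:2608.06879v1 p. 24) (claim; preprint; shape only)] -/
theorem anticyclotomicSpecialisationAtZpThree_of_orbit
    (hA : AcMainConjectureOrbitAtZpThree W) (hB : AcBottomReadingOrbitAtZpThree W) :
    AnticyclotomicDescentThree.AnticyclotomicSpecialisationAtZpThree W := by
  intro K _ _ 𝔭 W' _ _ C hF hr hh huniq Φ η hcard hle hstab hpair hlift hker hJLK κ hκ γ _ hA𝔭 hA𝔭' hAv
  obtain ⟨ι, φ, Ω, 𝓔, D, hΩ, hL, hIMC⟩ :=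
    hA K 𝔭 W' C hF hr hh huniq Φ η hcard hle hstab hpair hlift hker hJLK κ hκ γ hA𝔭 hA𝔭' hAv
  obtain ⟨c, hc, hT0⟩ := hB K 𝔭 W' C hF hr κ hκ γ hA𝔭 hA𝔭' hAv ι φ Ω 𝓔 D hΩ hL hIMC
  exact ⟨ι, φ, Ω, 𝓔, D, c, hΩ, hL, hc, hT0⟩

/-- **(A𝒪) ∧ (B𝒪) ∧ JLK's named fact ⟹ the Zp₃ carrier (R-IMC)∃-Zp₃ at `W`** (PROVED: the join composed
with p559951's `ramifiedCMEllipticUnitIMCAtZpThree_of_sec54_of_specialisation`).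
[cite: JohnsonLeungKings2011, §5.4 (arXiv:0804.2828 p0016:L19–26)]
[cite: BurungaleKobayashiNakamuraOta2026, Thm. 3.14 (3) (arXiv:2608.06879v1 p. 24) (claim; preprint)] -/
theorem ramifiedCMEllipticUnitIMCAtZpThree_of_sec54_of_orbit
    (h54 : sec54_charIdeal_classGroup_eq_unitIndex)
    (hA : AcMainConjectureOrbitAtZpThree W) (hB : AcBottomReadingOrbitAtZpThree W) :
    RamifiedCMEllipticUnitIMCAtZpThree W :=
  AnticyclotomicDescentThree.ramifiedCMEllipticUnitIMCAtZpThree_of_sec54_of_specialisation h54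
    (anticyclotomicSpecialisationAtZpThree_of_orbit hA hB)

/-! ## §5 Slice forms and the join on the slice (binders of item 21353) -/

/-- **(A𝒪) on the whole `p = 3` slice** (binders of item 21353). `@[conjecture]`, nothing asserted.
[cite: BurungaleKobayashiNakamuraOta2026, Thm. 3.14 (3) (arXiv:2608.06879v1 p. 24) (claim; preprint; shape only)] -/
@[conjecture] def AcMainConjectureOrbitThree : Prop :=
  ∀ (W : WeierstrassCurve ℚ) [W.IsElliptic] [W.IsGloballyMinimal],
    W.HasCM → CMRamified W 3 → W.analyticRank = 1 → AcMainConjectureOrbitAtZpThree W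

/-- **(B𝒪) on the whole `p = 3` slice** (binders of item 21353). `@[conjecture]`, nothing asserted.
[cite: GreenbergLNM1716, §4 Lemma 4.2 (p. 85) (shape only)] -/
@[conjecture] def AcBottomReadingOrbitThree : Prop :=
  ∀ (W : WeierstrassCurve ℚ) [W.IsElliptic] [W.IsGloballyMinimal],
    W.HasCM → CMRamified W 3 → W.analyticRank = 1 → AcBottomReadingOrbitAtZpThree W

/-- **(A𝒪)-slice ∧ (B𝒪)-slice ⟹ the slice lemma `AnticyclotomicSpecialisationThree`** (PROVED join) —
so, with p561883's `ellipticUnitIMCThree_of_sec54_of_specialisation`, item 21353 ⟸ JLK's named fact ∧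
(A𝒪) ∧ (B𝒪). [cite: BurungaleKobayashiNakamuraOta2026, Thm. 3.14 (3) (arXiv:2608.06879v1 p. 24) (claim; preprint; shape only)] -/
theorem anticyclotomicSpecialisationThree_of_orbit
    (hA : AcMainConjectureOrbitThree) (hB : AcBottomReadingOrbitThree) :
    AnticyclotomicDescentThree.AnticyclotomicSpecialisationThree :=
  fun W _ _ hCM hram hr ↦
    anticyclotomicSpecialisationAtZpThree_of_orbit (hA W hCM hram hr) (hB W hCM hram hr)

/-- **The body of item 21353 from JLK's named fact ∧ (A𝒪)-slice ∧ (B𝒪)-slice** (PROVED; verbatim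
the body of `Theses.PrintCFram.EllipticUnitIMCThree`; the route-level statement is the one-liner
`ellipticUnitIMCThree_of_sec54_of_specialisation h54 (anticyclotomicSpecialisationThree_of_orbit hA hB)`
of p561883's file). [cite: JohnsonLeungKings2011, §5.4 (arXiv:0804.2828 p0016:L19–26)]
[cite: BurungaleKobayashiNakamuraOta2026, Thm. 3.14 (3) (arXiv:2608.06879v1 p. 24) (claim; preprint)] -/
theorem forall_imcAtZpThree_of_sec54_of_orbit
    (h54 : sec54_charIdeal_classGroup_eq_unitIndex) (hA : AcMainConjectureOrbitThree)
    (hB : AcBottomReadingOrbitThree) :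
    ∀ (W : WeierstrassCurve ℚ) [W.IsElliptic] [W.IsGloballyMinimal],
      W.HasCM → CMRamified W 3 → W.analyticRank = 1 → RamifiedCMEllipticUnitIMCAtZpThree W :=
  AnticyclotomicDescentThree.forall_imcAtZpThree_of_sec54_of_specialisationThree h54
    (anticyclotomicSpecialisationThree_of_orbit hA hB)

/-! ## §6 Comparison with p1's pieces -/

/-- **(A)'s torsion conjunct implies (A𝒪)'s**: for every relaxed datum `𝒮` and every `zac ∈ 𝒮.S`
projecting to `(D.z n)_n`, `Λ`-torsion of `𝒮.S ⧸ Λ·zac` implies `Λ`-torsion of `𝒮.S ⧸ Λ_𝒪·z^ac` (the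
orbit span contains `Λ·zac`). The converse is the point of the repair: `𝒮.S ⧸ Λ·zac` has `Λ`-rank
`≥ 1` ([BKNO] Prop. 3.7 (3): `𝒮^ac_rel` has `Λ_𝒪`-rank one, `Λ`-rank two) and is never torsion.
[cite: BurungaleKobayashiNakamuraOta2026, Prop. 3.7 (3) (arXiv:2608.06879v1 p. 19) (claim; preprint; shape only)] -/
theorem isTorsion_quotient_endOrbitSpan_of_isTorsion_quotient_span
    {K : Type} [Field K] [NumberField K] {p : ℕ} [Fact p.Prime] {V : WeierstrassCurve K}
    {κ : ZpExtension K p} {γ : absoluteGaloisGroup K} {𝔭 : HeightOneSpectrum (𝓞 K)}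
    (𝒮 : LambdaAdicRelaxedSelmerData V κ γ 𝔭)
    {z : Π n k : ℕ, V.torsionH1Over ((p : ℤ) ^ k) (κ.layerSubgroup n)} {zac : 𝒮.S}
    (hzac : ∀ n, 𝒮.proj n zac = z n)
    (h : Module.IsTorsion (IwasawaAlgebra p) (𝒮.S ⧸ Submodule.span (IwasawaAlgebra p) {zac})) :
    Module.IsTorsion (IwasawaAlgebra p) (𝒮.S ⧸ endOrbitSpan 𝒮 z) :=
  isTorsion_quotient_mono (span_le_endOrbitSpan_of_proj_eq 𝒮 hzac) h

end Summit.BirchSwinnertonDyer.BirchSwinnertonDyer.Theorems.PrintCFram.AcDescentThreeOrbit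

end
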